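import Literature.NumberTheory.Automorphic.POrdinaryHeckeAlgebraGL2
import Literature.NumberTheory.Automorphic.AdicCompletionLocalField
import Literature.NumberTheory.GaloisRepresentations.DeformationCoefficientAlgebras
import HarnessLib

/-!
# The universal ordinary determinant deformation ring framed by local characters (interface)

Topic `Literature/NumberTheory/GaloisRepresentations`.  Requested by the crux plan
`Langlands/DyadicEisensteinFM`, line `thorne-dense-weight-two` (item D0: the ring behind the
consumer's posited `OrdDetFamily`).  For a number field `F`, a prime `p`, a coefficient ring `𝒪`
with residue field `k` and a RESIDUAL DATUM `𝒟` — a finite set `S` of finite places containing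
those above `p`, a continuous two-dimensional Chenevier determinant `D̄ = (T̄, d̄) : Γ_F → k`
(`PseudoRep2`, the trace–determinant form valid in characteristic `2`) unramified outside `S`,
for every `v ∣ p` two continuous characters `ψ̄₁⁽ᵛ⁾, ψ̄₂⁽ᵛ⁾ : Γ_{F_v} → kˣ` FRAMING it
(`D̄|_{Γ_{F_v}} = ψ̄₁⁽ᵛ⁾ ⊕ ψ̄₂⁽ᵛ⁾`), an exponent `m ≥ 1` with `(ψ̄₂⁽ᵛ⁾)^m = 1` on the inertia group
`absInertia F_v`, and a flag saying whether the ODD condition `d̄(c) = -1` at complex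
conjugations is imposed — this file sets up the deformation problem of the triples
`(D, ψ₁, ψ₂)` and the interface of its universal ring `R^{ps,ord}_S(𝒟)`:

* `Deformation.IsAdicContinuousFun f`: Mazur's profinite continuity of a function `f : Γ → A`
  into a local ring (`f mod 𝔪_A^m` is locally constant for every `m`; no topology on `A` is
  needed), with `map` (push-forward along local homomorphisms), `of_isLocallyConstant`, and
  `continuous` (it IS continuity when `A` carries the `𝔪_A`-adic topology).
* `OrdDetTriple F p A`: the data `(D, ψ₁, ψ₂)` over a commutative ring `A` — a determinant
  `D : Γ_F → A` of dimension `2` and, for each `v ∣ p`, characters `ψ₁⁽ᵛ⁾, ψ₂⁽ᵛ⁾ : Γ_{F_v} → Aˣ`;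
  change of rings `map` (`map_id`, `map_map`); the CLOSED CONDITIONS `IsOrdinary m odd`
  (`D|_{Γ_{F_v}} = ψ₁⁽ᵛ⁾ ⊕ ψ₂⁽ᵛ⁾` via `PseudoRep2.comp` / `PseudoRep2.ofCharacters`,
  `(ψ₂⁽ᵛ⁾)^m = 1` on `absInertia F_v`, and `odd → det D(c) = -1` at every complex conjugation),
  stable under `map` (`IsOrdinary.map`).
* `OrdinaryDeterminantDatum F p 𝒪 k`: the residual datum `𝒟` (its residual triple is a `k`-point
  of the problem: `isDeformation_self`), and for a local `𝒪`-algebra `A` augmented by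
  `π : A →ₐ[𝒪] k` the predicate `𝒟.IsDeformation π t`: `t` is adically continuous, reduces to
  the residual triple (`t.map π = 𝒟.residual`), `t.D` is unramified outside `S`
  (`PseudoRep2.IsUnramifiedAt`), and `t` satisfies the closed conditions; `IsDeformation.map`
  (functoriality in `A`).  NO multiplicity-freeness / `p`-distinguishedness of `D̄` is assumed:
  the framing characters replace the GMA-based ordinary condition of Wake–Wang-Erickson
  (which needs `ψ̄₁⁽ᵛ⁾ ≠ ψ̄₂⁽ᵛ⁾`), and determinants replace Wiles' pseudo-representations (which
  need `p > 2`).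
* THE INTERFACE `OrdinaryDeterminantDeformationRing 𝒟`: a complete Noetherian local
  `𝒪`-algebra `R` carrying its `𝔪_R`-adic topology (profinite: compact Hausdorff), an
  augmentation `π : R →ₐ[𝒪] k` onto `k`, a universal triple `(D, ψ₁, ψ₂)` which is a
  deformation of `𝒟`, TOPOLOGICAL GENERATION of `R` over `𝒪` by the `T(g), det D(g), ψᵢ⁽ᵛ⁾(σ)`
  (`dense_adjoin`), and UNIVERSALITY: every deformation of `𝒟` to a complete Noetherian local
  `𝒪`-algebra `A` with residue field `k` is `t.map φ` for a unique `𝒪`-algebra map `φ : R → A`.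
  Derived, all proved: continuity of the universal `T`, `det` (`isContinuous`), the universal
  characters as continuous homomorphisms `ordChar₁ ordChar₂ : Γ_{F_v} →ₜ* Rˣ` with
  `comp_toLocal`, `ordChar₂_pow`, `finite_ramification`, the classifying map `lift`
  (`map_lift`, `lift_unique`), `ker_π` (compatibility of every `𝒪`-algebra map with the
  augmentations is `OrdinaryDeterminantDatum.residue_comp_algHom`, from
  `Deformation.CNLAlgebra.algHom_residueField_unique`).
* THE CONSTRUCTION as a named fact `ordinaryDeterminantDeformationRing_nonempty` (`k` finite of
  characteristic `p`, `𝒪` a coefficient ring): see its docstring for exactly what is printed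
  where.

## Design

* As in `NearlyOrdinaryDeformationRing`: coefficient rings through augmentations onto `k`
  (Mazur's `Ĉ_𝒪(k)`; augmentations are unique, so morphisms are all `𝒪`-algebra maps and are
  local), continuity of test objects recorded adically, universality over test rings
  `A : Type u` in the universe of `R`.  The universal ring itself carries a genuine topology
  (field `isAdic`), because its consumers want continuous points `R → ℚ̄_p` and continuous
  characters `Γ_{F_v} →ₜ* Rˣ`.
* `ψ₂` is determined by `(D, ψ₁)` (`ψ₂ = det D|_{Γ_{F_v}} · ψ₁⁻¹`); both are kept, matching the
  Hecke-side interface `POrdinaryHeckeAlgebraGL2` (`ordChar₁`, `ordChar₂`, `comp_toLocal`).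
* Deliberately NOT here: the Iwasawa-algebra structure `Λ → R` (needs a local Artin map for
  `F_v`; the character `ψ₁⁽ᵛ⁾|_{I_v}` it is read from is exposed), generalized matrix algebras,
  reducibility ideals, tangent spaces and dimension counts, any `R = 𝕋` statement, and the
  classifying maps of points with residue field bigger than `k` (reduce to `universal` through
  the closed subalgebra generated by the coefficients, cf. `dense_adjoin`).

## References

* [Che] G. Chenevier, *The p-adic analytic space of pseudocharacters of a profinite group and
  pseudorepresentations over arbitrary rings*, LMS LNS 414 (2014) 221–285 = arXiv:0809.0415v2,
  Example 1.8 and Lemma 1.9 (determinants of dimension `2` = pairs `(T, D)`), §2.30 (continuous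
  determinants), §3.1: Lemma 3.2, Prop. 3.3 (= Prop. E of the introduction), Remark 3.5,
  Example 3.6, Prop. 3.7, Lemma 3.8 (numbering of arXiv v2 = the published text).
  [cite: Chenevier2014, §3.1 Prop. 3.3 and Prop. 3.7]
* [Maz] B. Mazur, *An introduction to the deformation theory of Galois representations*, in
  Modular Forms and Fermat's Last Theorem (1997), §2 (coefficient rings, profinite continuity),
  §18 (Grothendieck's theorem), §19 (relatively representable subfunctors).
  [cite: Mazur1997Deformation, §18–§19]
* P. Wake, C. Wang-Erickson, *Ordinary pseudorepresentations and modular forms*, Proc. AMS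
  Ser. B 4 (2017) (arXiv:1510.01661), §3.4–3.5 and Remark 3.4.2 (the GMA-based ordinary
  pseudodeformation ring, `p`-distinguished case) — context only, nothing is taken from it.
-/

noncomputable section

open scoped NumberField
open Field IsDedekindDomain IsLocalRing

namespace Literature.NumberTheory.GaloisRepresentations

open Literature.NumberTheory.Automorphic

universe u v

/-! ### Profinite continuity of functions into a local ring -/

namespace Deformation

section AdicContinuous

variable {Γ : Type*} [TopologicalSpace Γ] {A : Type*} [CommRing A] [IsLocalRing A]

/-- **Profinite (`𝔪_A`-adic) continuity** of a function `f : Γ → A` into a local ring: for every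
`m`, `f mod 𝔪_A^m : Γ → A/𝔪_A^m` is locally constant (continuous for the discrete topology) —
Mazur's convention that a coefficient ring `A = lim A/𝔪_A^ν` carries its profinite topology, so
that no topology on the abstract ring `A` is needed; for Chenevier a determinant is continuous
iff its coefficients `Λ_i : G → A` are.  Compare `Deformation.IsAdicContinuous` (the same
notion for `GL_n`-valued homomorphisms). [cite: Mazur1997Deformation, §2] -/
def IsAdicContinuousFun (f : Γ → A) : Prop :=
  ∀ m : ℕ, IsLocallyConstant (Ideal.Quotient.mk (maximalIdeal A ^ m) ∘ f)

/-- A locally constant function is adically continuous. [folklore] -/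
theorem IsAdicContinuousFun.of_isLocallyConstant {f : Γ → A} (hf : IsLocallyConstant f) :
    IsAdicContinuousFun f :=
  fun _ => hf.comp _

/-- Adic continuity is preserved by push-forward along a ring homomorphism `φ : A → B` with
`φ(𝔪_A) ⊆ 𝔪_B` (e.g. a local homomorphism): `φ ∘ f mod 𝔪_B^m` factors through `f mod 𝔪_A^m`.
[folklore] -/
theorem IsAdicContinuousFun.map {B : Type*} [CommRing B] [IsLocalRing B] {f : Γ → A}
    (hf : IsAdicContinuousFun f) (φ : A →+* B)
    (hφ : (maximalIdeal A).map φ ≤ maximalIdeal B) : IsAdicContinuousFun (φ ∘ f) := by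
  intro m
  have hle : maximalIdeal A ^ m ≤ (maximalIdeal B ^ m).comap φ := by
    rw [← Ideal.map_le_iff_le_comap, Ideal.map_pow]
    exact Ideal.pow_right_mono hφ m
  have hfac : Ideal.Quotient.mk (maximalIdeal B ^ m) ∘ φ ∘ f =
      Ideal.quotientMap (maximalIdeal B ^ m) φ hle ∘ (Ideal.Quotient.mk (maximalIdeal A ^ m) ∘ f) := by
    funext γ
    simp [Ideal.quotientMap_mk]
  rw [hfac]
  exact (hf m).comp _

/-- **Adic continuity is continuity for the `𝔪_A`-adic topology**: if `A` carries its
`𝔪_A`-adic topology, an adically continuous function is continuous (the translates `a + 𝔪_A^m`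
form a basis of neighbourhoods of `a`). [cite: Mazur1997Deformation, §2] -/
theorem IsAdicContinuousFun.continuous [TopologicalSpace A] (hA : IsAdic (maximalIdeal A))
    {f : Γ → A} (hf : IsAdicContinuousFun f) : Continuous f := by
  refine continuous_iff_continuousAt.2 fun γ => ?_
  rw [ContinuousAt, (hA.hasBasis_nhds (f γ)).tendsto_right_iff]
  intro m _
  have hU : {γ' | (Ideal.Quotient.mk (maximalIdeal A ^ m) ∘ f) γ' =
      (Ideal.Quotient.mk (maximalIdeal A ^ m) ∘ f) γ} ∈ nhds γ :=
    ((hf m).isOpen_fiber _).mem_nhds rfl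
  refine Filter.mem_of_superset hU fun γ' hγ' => ?_
  have hmem : f γ' - f γ ∈ maximalIdeal A ^ m := by
    rw [← Ideal.Quotient.eq]
    exact hγ'
  exact ⟨f γ' - f γ, hmem, by abel⟩

end AdicContinuous

end Deformation

/-! ### Framed determinants `(D, ψ₁, ψ₂)` -/

/-- An **ordinary-framed determinant triple** over the commutative ring `A`, for the number field
`F` and the prime `p`: a two-dimensional determinant `D = (T, det) : Γ_F → A` (Chenevier,
trace–determinant form `PseudoRep2`) together with, for each finite place `v` above `p`, two
characters `ψ₁⁽ᵛ⁾, ψ₂⁽ᵛ⁾ : Γ_{F_v} → Aˣ` of the local Galois group `Γ_{F_v} = Gal(F̄_v/F_v)`,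
`F_v = v.adicCompletion F` (the FRAMING: which summand of `D|_{Γ_{F_v}}` is "`ψ₂`" is part of the
data — a determinant alone cannot tell the sub from the quotient).  No condition is imposed
here; the closed conditions are `OrdDetTriple.IsOrdinary`. [cite: Chenevier2014, Lemma 1.9 and §3.1] -/
@[ext]
structure OrdDetTriple (F : Type*) [Field F] [NumberField F] (p : ℕ) (A : Type*) [CommRing A]
    where
  /-- The determinant `D : Γ_F → A` of dimension `2`. -/
  D : PseudoRep2 (absoluteGaloisGroup F) A
  /-- The first framing character `ψ₁⁽ᵛ⁾ : Γ_{F_v} → Aˣ` at a place `v ∣ p`. -/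
  char₁ : ∀ v : HeightOneSpectrum (𝓞 F), (p : 𝓞 F) ∈ v.asIdeal →
    (absoluteGaloisGroup (v.adicCompletion F) →* Aˣ)
  /-- The second framing character `ψ₂⁽ᵛ⁾ : Γ_{F_v} → Aˣ` (the one of finite order on inertia). -/
  char₂ : ∀ v : HeightOneSpectrum (𝓞 F), (p : 𝓞 F) ∈ v.asIdeal →
    (absoluteGaloisGroup (v.adicCompletion F) →* Aˣ)

namespace OrdDetTriple

variable {F : Type*} [Field F] [NumberField F] {p : ℕ} {A : Type*} [CommRing A]
  {B : Type*} [CommRing B] {C : Type*} [CommRing C]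

/-- Change of rings of a triple along `f : A →+* B` (`PseudoRep2.map` and `Units.map`).
[cite: Chenevier2014, §3.1] -/
def map (t : OrdDetTriple F p A) (f : A →+* B) : OrdDetTriple F p B where
  D := t.D.map f
  char₁ v hv := (Units.map (f : A →* B)).comp (t.char₁ v hv)
  char₂ v hv := (Units.map (f : A →* B)).comp (t.char₂ v hv)

/-- Unfolding lemma: the determinant of `t.map f`. [folklore] -/
@[simp] theorem map_D (t : OrdDetTriple F p A) (f : A →+* B) : (t.map f).D = t.D.map f := rfl

/-- Unfolding lemma: the first character of `t.map f`. [folklore] -/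
@[simp] theorem map_char₁ (t : OrdDetTriple F p A) (f : A →+* B) (v : HeightOneSpectrum (𝓞 F))
    (hv : (p : 𝓞 F) ∈ v.asIdeal) :
    (t.map f).char₁ v hv = (Units.map (f : A →* B)).comp (t.char₁ v hv) := rfl

/-- Unfolding lemma: the second character of `t.map f`. [folklore] -/
@[simp] theorem map_char₂ (t : OrdDetTriple F p A) (f : A →+* B) (v : HeightOneSpectrum (𝓞 F))
    (hv : (p : 𝓞 F) ∈ v.asIdeal) :
    (t.map f).char₂ v hv = (Units.map (f : A →* B)).comp (t.char₂ v hv) := rfl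

/-- `map` along the identity. [folklore] -/
@[simp] theorem map_id (t : OrdDetTriple F p A) : t.map (RingHom.id A) = t := by
  refine OrdDetTriple.ext ?_ (funext fun v => funext fun hv => MonoidHom.ext fun σ => Units.ext rfl)
    (funext fun v => funext fun hv => MonoidHom.ext fun σ => Units.ext rfl)
  exact PseudoRep2.ext (funext fun _ => rfl) (MonoidHom.ext fun _ => Units.ext rfl)

/-- `map` is functorial. [folklore] -/
theorem map_map (t : OrdDetTriple F p A) (f : A →+* B) (g : B →+* C) :
    (t.map f).map g = t.map (g.comp f) := by
  refine OrdDetTriple.ext ?_ (funext fun v => funext fun hv => MonoidHom.ext fun σ => Units.ext rfl)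
    (funext fun v => funext fun hv => MonoidHom.ext fun σ => Units.ext rfl)
  exact PseudoRep2.map_map _ _ _

/-- Restriction of a determinant to a subgroup commutes with change of rings. [folklore] -/
theorem _root_.Literature.NumberTheory.Automorphic.PseudoRep2.comp_map {G : Type*} [Group G]
    {H : Type*} [Group H] (D : PseudoRep2 G A) (φ : H →* G) (f : A →+* B) :
    (D.map f).comp φ = (D.comp φ).map f :=
  PseudoRep2.ext (funext fun _ => rfl) (MonoidHom.ext fun _ => Units.ext rfl)

/-- Unramifiedness of a determinant of `Γ_K` at a finite place is preserved by change of rings.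
[folklore] -/
theorem _root_.Literature.NumberTheory.Automorphic.PseudoRep2.IsUnramifiedAt.map {K : Type*}
    [Field K] [NumberField K] {v : HeightOneSpectrum (𝓞 K)} {D : PseudoRep2 (absoluteGaloisGroup K) A}
    (h : D.IsUnramifiedAt v) (f : A →+* B) : (D.map f).IsUnramifiedAt v := by
  intro 𝔓 h𝔓 σ hσ
  obtain ⟨htr, hdet⟩ := h 𝔓 h𝔓 σ hσ
  refine ⟨fun g => ?_, Units.ext ?_⟩
  · simp [htr g]
  · simp [hdet]

/-- The **closed conditions** of the ordinary-framed problem with inertial exponent `m` and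
oddness flag `odd`: (i) ORDINARY SHAPE `D|_{Γ_{F_v}} = ψ₁⁽ᵛ⁾ ⊕ ψ₂⁽ᵛ⁾` (restriction along the
tree's fixed `absGaloisRestrict F F_v : Γ_{F_v} → Γ_F`), (ii) `(ψ₂⁽ᵛ⁾)^m = 1` on the inertia
group `I_{F_v} = absInertia F_v`, (iii) if `odd` holds, `det D(c) = -1` for every complex
conjugation `c` of every real embedding (`IsComplexConjugation`; vacuous for totally complex
`F`).  These are equations between values of `T`, `det D`, `ψᵢ⁽ᵛ⁾`, hence define a relatively
representable subfunctor in Mazur's sense. [cite: Mazur1997Deformation, §19] -/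
structure IsOrdinary (m : ℕ) (odd : Prop) (t : OrdDetTriple F p A) : Prop where
  /-- ordinary shape: `D|_{Γ_{F_v}} = ψ₁⁽ᵛ⁾ ⊕ ψ₂⁽ᵛ⁾` -/
  comp_toLocal : ∀ (v : HeightOneSpectrum (𝓞 F)) (hv : (p : 𝓞 F) ∈ v.asIdeal),
    t.D.comp (absGaloisRestrict F (v.adicCompletion F)).toMonoidHom =
      PseudoRep2.ofCharacters (t.char₁ v hv) (t.char₂ v hv)
  /-- `ψ₂⁽ᵛ⁾` has order dividing `m` on inertia -/
  char₂_pow : ∀ (v : HeightOneSpectrum (𝓞 F)) (hv : (p : 𝓞 F) ∈ v.asIdeal)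
    (σ : absoluteGaloisGroup (v.adicCompletion F)), σ ∈ absInertia (v.adicCompletion F) →
      t.char₂ v hv σ ^ m = 1
  /-- the odd condition, when imposed -/
  det_eq_neg_one : odd → ∀ (φ : F →+* ℝ) (c : absoluteGaloisGroup F), IsComplexConjugation φ c →
    (t.D.det c : A) = -1

/-- The closed conditions are preserved by change of rings. [folklore] -/
theorem IsOrdinary.map {m : ℕ} {odd : Prop} {t : OrdDetTriple F p A} (h : t.IsOrdinary m odd)
    (f : A →+* B) : (t.map f).IsOrdinary m odd := by
  refine ⟨fun v hv => ?_, fun v hv σ hσ => ?_, fun ho φ c hc => ?_⟩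
  · rw [map_D, PseudoRep2.comp_map, h.comp_toLocal v hv, PseudoRep2.ofCharacters_map]
    rfl
  · rw [map_char₂, MonoidHom.comp_apply, ← map_pow, h.char₂_pow v hv σ hσ, map_one]
  · rw [map_D, PseudoRep2.map_det, h.det_eq_neg_one ho φ c hc, map_neg, map_one]

end OrdDetTriple

/-! ### The residual datum and the deformation problem -/

/-- An **ordinary determinant residual datum** `𝒟` for the number field `F`, the prime `p` and
the coefficient ring `𝒪` with residue field `k` (`algebraMap 𝒪 k` onto): a finite set `S` of
finite places containing all `v ∣ p`; a residual triple `(D̄, ψ̄₁, ψ̄₂)` over `k` — `D̄ : Γ_F → k`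
a two-dimensional determinant and framing characters `ψ̄ᵢ⁽ᵛ⁾ : Γ_{F_v} → kˣ` at `v ∣ p` — which
is CONTINUOUS (locally constant, `k` discrete), with `D̄` unramified outside `S`; the inertial
exponent `ordExponent = m ≥ 1`; the flag `imposeOdd`; and the requirement that the residual
triple itself satisfies the closed conditions (`residual_isOrdinary`), so that it is a `k`-point
of the problem.  Typical instance: `D̄ = χ̄₁ ⊕ χ̄₂` the semisimplified reduction of a residually
reducible `p`-adic representation, `ψ̄ᵢ⁽ᵛ⁾ = χ̄ᵢ|_{Γ_{F_v}}`; NO hypothesis `ψ̄₁⁽ᵛ⁾ ≠ ψ̄₂⁽ᵛ⁾`.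
[cite: Chenevier2014, §3.1] -/
structure OrdinaryDeterminantDatum (F : Type*) [Field F] [NumberField F] (p : ℕ) (𝒪 : Type v)
    [CommRing 𝒪] (k : Type v) [Field k] [Algebra 𝒪 k] where
  /-- `𝒪 → k` is onto: `k` is the residue field of the coefficient ring. -/
  residueMap_surjective : Function.Surjective (algebraMap 𝒪 k)
  /-- The finite set `S` of finite places where ramification is allowed. -/
  S : Set (HeightOneSpectrum (𝓞 F))
  S_finite : S.Finite
  /-- `S` contains every place above `p`. -/
  mem_S_of_mem : ∀ v : HeightOneSpectrum (𝓞 F), (p : 𝓞 F) ∈ v.asIdeal → v ∈ S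
  /-- The residual triple `(D̄, ψ̄₁, ψ̄₂)`. -/
  residual : OrdDetTriple F p k
  /-- `T̄` is locally constant (continuous for the discrete topology on `k`). -/
  isLocallyConstant_trace : IsLocallyConstant residual.D.trace
  /-- `d̄ = det D̄` is locally constant. -/
  isLocallyConstant_det : IsLocallyConstant fun g => (residual.D.det g : k)
  /-- `ψ̄₁⁽ᵛ⁾` is locally constant. -/
  isLocallyConstant_char₁ : ∀ (v : HeightOneSpectrum (𝓞 F)) (hv : (p : 𝓞 F) ∈ v.asIdeal),
    IsLocallyConstant fun σ => (residual.char₁ v hv σ : k)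
  /-- `ψ̄₂⁽ᵛ⁾` is locally constant. -/
  isLocallyConstant_char₂ : ∀ (v : HeightOneSpectrum (𝓞 F)) (hv : (p : 𝓞 F) ∈ v.asIdeal),
    IsLocallyConstant fun σ => (residual.char₂ v hv σ : k)
  /-- `D̄` is unramified outside `S`. -/
  residual_unramified : ∀ v ∉ S, residual.D.IsUnramifiedAt v
  /-- The inertial exponent `m` of `ψ₂`. -/
  ordExponent : ℕ
  ordExponent_pos : 0 < ordExponent
  /-- Whether the odd condition `det D(c) = -1` is imposed. -/
  imposeOdd : Prop
  /-- The residual triple satisfies the closed conditions. -/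
  residual_isOrdinary : residual.IsOrdinary ordExponent imposeOdd

namespace OrdinaryDeterminantDatum

variable {F : Type*} [Field F] [NumberField F] {p : ℕ} {𝒪 : Type v} [CommRing 𝒪] {k : Type v}
  [Field k] [Algebra 𝒪 k]

section Deformations

variable (𝒟 : OrdinaryDeterminantDatum F p 𝒪 k) {A : Type*} [CommRing A] [IsLocalRing A]
  [Algebra 𝒪 A]

/-- A **deformation of `𝒟`** to the local `𝒪`-algebra `A` augmented by `π : A →ₐ[𝒪] k` (an
`A`-point of the ordinary-framed determinant problem): a triple `t = (D, ψ₁, ψ₂)` over `A` which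
is adically continuous (Chenevier: continuous determinant and characters), REDUCES TO THE
RESIDUAL TRIPLE (`t mod 𝔪_A = (D̄, ψ̄₁, ψ̄₂)`, i.e. `t.map π = 𝒟.residual`), has `D` unramified
outside `S` (equivalently `D` is a determinant of `G_{F,S}`), and satisfies the closed
conditions with the exponent and oddness flag of `𝒟`.  No quotient by any equivalence is taken:
determinants and characters have no framing ambiguity. [cite: Chenevier2014, §3.1 (the functor `F`)] -/
structure IsDeformation (π : A →ₐ[𝒪] k) (t : OrdDetTriple F p A) : Prop where
  isAdicContinuous_trace : Deformation.IsAdicContinuousFun t.D.trace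
  isAdicContinuous_det : Deformation.IsAdicContinuousFun fun g => (t.D.det g : A)
  isAdicContinuous_char₁ : ∀ (v : HeightOneSpectrum (𝓞 F)) (hv : (p : 𝓞 F) ∈ v.asIdeal),
    Deformation.IsAdicContinuousFun fun σ => (t.char₁ v hv σ : A)
  isAdicContinuous_char₂ : ∀ (v : HeightOneSpectrum (𝓞 F)) (hv : (p : 𝓞 F) ∈ v.asIdeal),
    Deformation.IsAdicContinuousFun fun σ => (t.char₂ v hv σ : A)
  map_residue : t.map (π : A →+* k) = 𝒟.residual
  unramified : ∀ v ∉ 𝒟.S, t.D.IsUnramifiedAt v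
  isOrdinary : t.IsOrdinary 𝒟.ordExponent 𝒟.imposeOdd

/-- **The residual triple is a deformation of `𝒟` to `k`** (the problem has a `k`-point, so its
universal ring, when it exists, is a local ring with residue field `k` rather than `0`).
[cite: Chenevier2014, §3.1] -/
theorem isDeformation_self : 𝒟.IsDeformation (AlgHom.id 𝒪 k) 𝒟.residual where
  isAdicContinuous_trace := .of_isLocallyConstant 𝒟.isLocallyConstant_trace
  isAdicContinuous_det := .of_isLocallyConstant 𝒟.isLocallyConstant_det
  isAdicContinuous_char₁ v hv := .of_isLocallyConstant (𝒟.isLocallyConstant_char₁ v hv)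
  isAdicContinuous_char₂ v hv := .of_isLocallyConstant (𝒟.isLocallyConstant_char₂ v hv)
  map_residue := 𝒟.residual.map_id
  unramified := 𝒟.residual_unramified
  isOrdinary := 𝒟.residual_isOrdinary

include 𝒟 in
/-- Every `𝒪`-algebra map `φ : A → B` between local `𝒪`-algebras augmented onto `k` is
compatible with the augmentations, `πB ∘ φ = πA` — augmentations are unique when `𝒪 → k` is onto
(`Deformation.CNLAlgebra.algHom_residueField_unique`), so morphisms of augmented local
`𝒪`-algebras are just `𝒪`-algebra maps. [cite: Mazur1997Deformation, §2] -/
theorem residue_comp_algHom {B : Type*} [CommRing B] [IsLocalRing B] [Algebra 𝒪 B]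
    (πA : A →ₐ[𝒪] k) (πB : B →ₐ[𝒪] k) (φ : A →ₐ[𝒪] B) : πB.comp φ = πA :=
  Deformation.CNLAlgebra.algHom_residueField_unique 𝒟.residueMap_surjective _ _

include 𝒟 in
/-- An `𝒪`-algebra map `φ : A → B` between local `𝒪`-algebras augmented ONTO `k` maps `𝔪_A`
into `𝔪_B` (it is compatible with the augmentations by `residue_comp_algHom`).
[cite: Mazur1997Deformation, §2] -/
theorem map_maximalIdeal_le {B : Type*} [CommRing B] [IsLocalRing B] [Algebra 𝒪 B]
    (πA : A →ₐ[𝒪] k) (hπA : Function.Surjective πA) (πB : B →ₐ[𝒪] k)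
    (hπB : Function.Surjective πB) (φ : A →ₐ[𝒪] B) :
    (maximalIdeal A).map (φ : A →+* B) ≤ maximalIdeal B := by
  rw [Ideal.map_le_iff_le_comap]
  intro a ha
  rw [← IsLocalRing.ker_eq_maximalIdeal (πA : A →+* k) hπA, RingHom.mem_ker] at ha
  rw [Ideal.mem_comap, ← IsLocalRing.ker_eq_maximalIdeal (πB : B →+* k) hπB, RingHom.mem_ker,
    RingHom.coe_coe, RingHom.coe_coe, ← AlgHom.comp_apply, 𝒟.residue_comp_algHom πA πB φ]
  exact ha

/-- **Functoriality of deformations**: the push-forward of a deformation of `𝒟` along an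
`𝒪`-algebra map of augmented local `𝒪`-algebras (augmentations onto `k`) is a deformation.
[cite: Chenevier2014, §3.1] -/
theorem IsDeformation.map {B : Type*} [CommRing B] [IsLocalRing B] [Algebra 𝒪 B]
    {πA : A →ₐ[𝒪] k} {t : OrdDetTriple F p A} (h : 𝒟.IsDeformation πA t)
    (hπA : Function.Surjective πA) (πB : B →ₐ[𝒪] k) (hπB : Function.Surjective πB)
    (φ : A →ₐ[𝒪] B) : 𝒟.IsDeformation πB (t.map (φ : A →+* B)) := by
  have hφ := 𝒟.map_maximalIdeal_le πA hπA πB hπB φ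
  refine ⟨h.isAdicContinuous_trace.map _ hφ, h.isAdicContinuous_det.map _ hφ,
    fun v hv => (h.isAdicContinuous_char₁ v hv).map _ hφ,
    fun v hv => (h.isAdicContinuous_char₂ v hv).map _ hφ, ?_,
    fun v hv => (h.unramified v hv).map _, h.isOrdinary.map _⟩
  rw [OrdDetTriple.map_map]
  have hcomp : (πB : B →+* k).comp (φ : A →+* B) = (πA : A →+* k) :=
    congrArg (fun e : A →ₐ[𝒪] k => (e : A →+* k)) (𝒟.residue_comp_algHom πA πB φ)
  rw [hcomp, h.map_residue]

end Deformations

end OrdinaryDeterminantDatum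

/-! ### The interface: the universal ordinary determinant deformation ring -/

/-- **A universal ordinary determinant deformation ring of the residual datum `𝒟`, framed by
local characters** — the ring `R^{ps,ord}_S(𝒟)` pro-representing the triples `(D, ψ₁, ψ₂)` — as
an INTERFACE: a complete Noetherian local `𝒪`-algebra `R` (universe `u`) equipped with its
`𝔪_R`-adic topology, which is profinite (compact Hausdorff topological ring), an augmentation
`π : R →ₐ[𝒪] k` ONTO `k`, a universal triple `triple = (D, ψ₁, ψ₂)` which is a deformation of
`𝒟` to `(R, π)`, TOPOLOGICAL GENERATION of `R` as an `𝒪`-algebra by the values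
`T(g), det D(g), ψᵢ⁽ᵛ⁾(σ)` (Chenevier's Remark 3.5), and the UNIVERSAL PROPERTY: for every complete
Noetherian local `𝒪`-algebra `A : Type u` with an augmentation `πA` onto `k` and every
deformation `t` of `𝒟` to `(A, πA)` there is a unique `𝒪`-algebra map `φ : R → A` (automatically
local and continuous) with `triple.map φ = t` (Chenevier's Prop. 3.3 with Lemma 3.2 for the
determinant, cut out by the closed conditions).  Existence is the named fact
`ordinaryDeterminantDeformationRing_nonempty`.
[cite: Chenevier2014, §3.1 Prop. 3.3, Remark 3.5 and Prop. 3.7] -/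
structure OrdinaryDeterminantDeformationRing {F : Type*} [Field F] [NumberField F] {p : ℕ}
    {𝒪 : Type v} [CommRing 𝒪] {k : Type v} [Field k] [Algebra 𝒪 k]
    (𝒟 : OrdinaryDeterminantDatum F p 𝒪 k) where
  /-- The underlying ring `R = R^{ps,ord}_S(𝒟)`. -/
  R : Type u
  [instCommRing : CommRing R]
  [instIsLocalRing : IsLocalRing R]
  [instIsNoetherianRing : IsNoetherianRing R]
  [instAlgebra : Algebra 𝒪 R]
  [instIsAdicComplete : IsAdicComplete (maximalIdeal R) R]
  [instTopologicalSpace : TopologicalSpace R]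
  [instIsTopologicalRing : IsTopologicalRing R]
  [instCompactSpace : CompactSpace R]
  [instT2Space : T2Space R]
  /-- The topology of `R` is the `𝔪_R`-adic topology. -/
  isAdic : IsAdic (maximalIdeal R)
  /-- The augmentation `R → k`. -/
  π : R →ₐ[𝒪] k
  /-- The augmentation is onto: `R/𝔪_R = k`. -/
  π_surjective : Function.Surjective π
  /-- The universal triple `(D, ψ₁, ψ₂)` over `R`. -/
  triple : OrdDetTriple F p R
  /-- The universal triple is a deformation of `𝒟`. -/
  isDeformation : 𝒟.IsDeformation π triple
  /-- `R` is topologically generated over `𝒪` by the `T(g)`, `det D(g)` and `ψᵢ⁽ᵛ⁾(σ)`. -/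
  dense_adjoin : Dense ((Algebra.adjoin 𝒪
    (Set.range triple.D.trace ∪ Set.range (fun g => (triple.D.det g : R)) ∪
      (⋃ (v : HeightOneSpectrum (𝓞 F)) (hv : (p : 𝓞 F) ∈ v.asIdeal),
        Set.range fun σ => (triple.char₁ v hv σ : R)) ∪
      ⋃ (v : HeightOneSpectrum (𝓞 F)) (hv : (p : 𝓞 F) ∈ v.asIdeal),
        Set.range fun σ => (triple.char₂ v hv σ : R)) : Subalgebra 𝒪 R) : Set R)
  /-- Universality among deformations of `𝒟` to complete Noetherian local `𝒪`-algebras with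
  residue field `k`. -/
  universal : ∀ (A : Type u) [CommRing A] [IsLocalRing A] [IsNoetherianRing A] [Algebra 𝒪 A]
    [IsAdicComplete (maximalIdeal A) A] (πA : A →ₐ[𝒪] k), Function.Surjective πA →
    ∀ t : OrdDetTriple F p A, 𝒟.IsDeformation πA t →
      ∃! φ : R →ₐ[𝒪] A, triple.map (φ : R →+* A) = t

namespace OrdinaryDeterminantDeformationRing

attribute [instance] instCommRing instIsLocalRing instIsNoetherianRing instAlgebra
  instIsAdicComplete instTopologicalSpace instIsTopologicalRing instCompactSpace instT2Space

variable {F : Type*} [Field F] [NumberField F] {p : ℕ} {𝒪 : Type v} [CommRing 𝒪] {k : Type v}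
  [Field k] [Algebra 𝒪 k] {𝒟 : OrdinaryDeterminantDatum F p 𝒪 k}
  (𝓡 : OrdinaryDeterminantDeformationRing.{u} 𝒟)

/-- The universal determinant `D : Γ_F → R`. [cite: Chenevier2014, §3.1 Prop. 3.3] -/
abbrev D : PseudoRep2 (absoluteGaloisGroup F) 𝓡.R := 𝓡.triple.D

/-- The kernel of the augmentation is the maximal ideal: `R/𝔪_R = k`. [folklore] -/
theorem ker_π : RingHom.ker (𝓡.π : 𝓡.R →+* k) = maximalIdeal 𝓡.R :=
  IsLocalRing.ker_eq_maximalIdeal _ 𝓡.π_surjective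

/-- The universal triple reduces to the residual one: `(D, ψ₁, ψ₂) mod 𝔪_R = (D̄, ψ̄₁, ψ̄₂)`.
[cite: Chenevier2014, §3.1] -/
theorem map_π : 𝓡.triple.map (𝓡.π : 𝓡.R →+* k) = 𝒟.residual :=
  𝓡.isDeformation.map_residue

/-- The universal trace `T : Γ_F → R` is continuous. [cite: Chenevier2014, §2.30 and §3.1] -/
theorem continuous_trace : Continuous 𝓡.D.trace :=
  𝓡.isDeformation.isAdicContinuous_trace.continuous 𝓡.isAdic

/-- The universal determinant character `det D : Γ_F → R` is continuous.
[cite: Chenevier2014, §2.30 and §3.1] -/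
theorem continuous_det : Continuous fun g => (𝓡.D.det g : 𝓡.R) :=
  𝓡.isDeformation.isAdicContinuous_det.continuous 𝓡.isAdic

/-- The universal determinant is continuous (`PseudoRep2.IsContinuous`).
[cite: Chenevier2014, §2.30 and §3.1] -/
theorem isContinuous : 𝓡.D.IsContinuous :=
  ⟨𝓡.continuous_trace, 𝓡.continuous_det⟩

/-- `D` is unramified outside the finite set `S` of the datum. [cite: Chenevier2014, §3.1] -/
theorem finite_ramification :
    ∃ S : Set (HeightOneSpectrum (𝓞 F)), S.Finite ∧ ∀ v, v ∉ S → 𝓡.D.IsUnramifiedAt v :=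
  ⟨𝒟.S, 𝒟.S_finite, 𝓡.isDeformation.unramified⟩

/-- `D` is unramified at every finite place outside `S`. [cite: Chenevier2014, §3.1] -/
theorem isUnramifiedAt (v : HeightOneSpectrum (𝓞 F)) (hv : v ∉ 𝒟.S) : 𝓡.D.IsUnramifiedAt v :=
  𝓡.isDeformation.unramified v hv

/-- `p ∈ 𝔪_R` when `k` has characteristic `p` (so `R` is a pro-`p`-adic ring: `p` is topologically
nilpotent). [folklore] -/
theorem natCast_mem_maximalIdeal [CharP k p] : (p : 𝓡.R) ∈ maximalIdeal 𝓡.R := by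
  rw [← 𝓡.ker_π, RingHom.mem_ker, map_natCast, CharP.cast_eq_zero]

/-- The universal trace reduces to the residual trace: `π (T g) = T̄ g`. [cite: Chenevier2014, §3.1] -/
theorem π_trace (g : absoluteGaloisGroup F) : 𝓡.π (𝓡.D.trace g) = 𝒟.residual.D.trace g := by
  have h := congrArg (fun t : OrdDetTriple F p k => t.D.trace g) 𝓡.map_π
  simpa using h

/-- The universal determinant character reduces to the residual one: `π (det D g) = d̄ g`.
[cite: Chenevier2014, §3.1] -/
theorem π_det (g : absoluteGaloisGroup F) : 𝓡.π (𝓡.D.det g) = 𝒟.residual.D.det g := by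
  have h := congrArg (fun t : OrdDetTriple F p k => (t.D.det g : k)) 𝓡.map_π
  simpa using h

/-- A character into `Rˣ` whose underlying `R`-valued function is adically continuous is a
continuous homomorphism for the topology of `Rˣ` (Mathlib's embedding `Rˣ ↪ R × Rᵐᵒᵖ`).
[folklore] -/
def continuousChar {G : Type*} [Group G] [TopologicalSpace G] [IsTopologicalGroup G]
    (χ : G →* (𝓡.R)ˣ) (hχ : Deformation.IsAdicContinuousFun fun σ => (χ σ : 𝓡.R)) :
    G →ₜ* (𝓡.R)ˣ where
  toMonoidHom := χ
  continuous_toFun := by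
    have hc : Continuous fun σ => (χ σ : 𝓡.R) := hχ.continuous 𝓡.isAdic
    refine Units.continuous_iff.2 ⟨hc, ?_⟩
    have h2 : Continuous ((fun σ => (χ σ : 𝓡.R)) ∘ fun σ : G => σ⁻¹) := hc.comp continuous_inv
    convert h2 using 1
    funext σ
    simp [map_inv]

/-- Unfolding lemma for `continuousChar`. [folklore] -/
@[simp] theorem continuousChar_toMonoidHom {G : Type*} [Group G] [TopologicalSpace G]
    [IsTopologicalGroup G] (χ : G →* (𝓡.R)ˣ)
    (hχ : Deformation.IsAdicContinuousFun fun σ => (χ σ : 𝓡.R)) :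
    (𝓡.continuousChar χ hχ).toMonoidHom = χ := rfl

/-- The **universal first framing character** `ψ₁⁽ᵛ⁾ : Γ_{F_v} →ₜ* Rˣ` at `v ∣ p`, as a continuous
homomorphism (its restriction to inertia carries the weight: the Iwasawa-algebra structure of
`R` is read from it through local class field theory, which is left to the user).
[cite: Chenevier2014, §3.1 Prop. 3.3] -/
def ordChar₁ (v : HeightOneSpectrum (𝓞 F)) (hv : (p : 𝓞 F) ∈ v.asIdeal) :
    absoluteGaloisGroup (v.adicCompletion F) →ₜ* (𝓡.R)ˣ :=
  𝓡.continuousChar (𝓡.triple.char₁ v hv) (𝓡.isDeformation.isAdicContinuous_char₁ v hv)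

/-- The **universal second framing character** `ψ₂⁽ᵛ⁾ : Γ_{F_v} →ₜ* Rˣ` at `v ∣ p` (the one of
finite order on inertia). [cite: Chenevier2014, §3.1 Prop. 3.3] -/
def ordChar₂ (v : HeightOneSpectrum (𝓞 F)) (hv : (p : 𝓞 F) ∈ v.asIdeal) :
    absoluteGaloisGroup (v.adicCompletion F) →ₜ* (𝓡.R)ˣ :=
  𝓡.continuousChar (𝓡.triple.char₂ v hv) (𝓡.isDeformation.isAdicContinuous_char₂ v hv)

/-- Unfolding lemma: `ordChar₁` is `ψ₁⁽ᵛ⁾`. [folklore] -/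
@[simp] theorem ordChar₁_toMonoidHom (v : HeightOneSpectrum (𝓞 F)) (hv : (p : 𝓞 F) ∈ v.asIdeal) :
    (𝓡.ordChar₁ v hv).toMonoidHom = 𝓡.triple.char₁ v hv := rfl

/-- Unfolding lemma: `ordChar₂` is `ψ₂⁽ᵛ⁾`. [folklore] -/
@[simp] theorem ordChar₂_toMonoidHom (v : HeightOneSpectrum (𝓞 F)) (hv : (p : 𝓞 F) ∈ v.asIdeal) :
    (𝓡.ordChar₂ v hv).toMonoidHom = 𝓡.triple.char₂ v hv := rfl

/-- **Ordinary shape of the universal determinant**: `D|_{Γ_{F_v}} = ψ₁⁽ᵛ⁾ ⊕ ψ₂⁽ᵛ⁾` for `v ∣ p`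
(the shape of the consumer's `OrdDetFamily.comp_toLocal`). [cite: Chenevier2014, §3.1] -/
theorem comp_toLocal (v : HeightOneSpectrum (𝓞 F)) (hv : (p : 𝓞 F) ∈ v.asIdeal) :
    𝓡.D.comp (absGaloisRestrict F (v.adicCompletion F)).toMonoidHom =
      PseudoRep2.ofCharacters (𝓡.ordChar₁ v hv).toMonoidHom (𝓡.ordChar₂ v hv).toMonoidHom :=
  𝓡.isDeformation.isOrdinary.comp_toLocal v hv

/-- `ψ₂⁽ᵛ⁾` has order dividing `ordExponent` on the inertia group `absInertia F_v`.
[cite: Chenevier2014, §3.1] -/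
theorem ordChar₂_pow (v : HeightOneSpectrum (𝓞 F)) (hv : (p : 𝓞 F) ∈ v.asIdeal)
    (σ : absoluteGaloisGroup (v.adicCompletion F)) (hσ : σ ∈ absInertia (v.adicCompletion F)) :
    𝓡.ordChar₂ v hv σ ^ 𝒟.ordExponent = 1 :=
  𝓡.isDeformation.isOrdinary.char₂_pow v hv σ hσ

/-- The odd condition on the universal determinant, when the datum imposes it:
`det D(c) = -1` at every complex conjugation. [cite: Chenevier2014, §3.1] -/
theorem det_eq_neg_one (hodd : 𝒟.imposeOdd) (φ : F →+* ℝ) (c : absoluteGaloisGroup F)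
    (hc : IsComplexConjugation φ c) : (𝓡.D.det c : 𝓡.R) = -1 :=
  𝓡.isDeformation.isOrdinary.det_eq_neg_one hodd φ c hc

section Classify

variable {A : Type u} [CommRing A] [IsLocalRing A] [IsNoetherianRing A] [Algebra 𝒪 A]
  [IsAdicComplete (maximalIdeal A) A] {πA : A →ₐ[𝒪] k} (hπA : Function.Surjective πA)
  {t : OrdDetTriple F p A} (ht : 𝒟.IsDeformation πA t)

/-- The **classifying map** `R → A` of a deformation `t` of `𝒟` to a complete Noetherian local
`𝒪`-algebra with residue field `k`. [cite: Chenevier2014, §3.1 Prop. 3.3] -/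
def lift : 𝓡.R →ₐ[𝒪] A :=
  (𝓡.universal A πA hπA t ht).exists.choose

/-- The classifying map carries the universal triple to `t`. [cite: Chenevier2014, §3.1 Prop. 3.3] -/
theorem map_lift : 𝓡.triple.map (𝓡.lift hπA ht : 𝓡.R →+* A) = t :=
  (𝓡.universal A πA hπA t ht).exists.choose_spec

/-- Uniqueness of the classifying map. [cite: Chenevier2014, §3.1 Prop. 3.3] -/
theorem lift_unique (φ : 𝓡.R →ₐ[𝒪] A) (hφ : 𝓡.triple.map (φ : 𝓡.R →+* A) = t) :
    φ = 𝓡.lift hπA ht :=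
  (𝓡.universal A πA hπA t ht).unique hφ (𝓡.map_lift hπA ht)

omit [IsNoetherianRing A] [IsAdicComplete (maximalIdeal A) A] in
include hπA in
/-- The push-forward of the universal triple along any `𝒪`-algebra map to a complete Noetherian
local `𝒪`-algebra with residue field `k` is a deformation of `𝒟` (so `universal` is a bijection
between `𝒪`-algebra maps `R → A` and deformations of `𝒟` to `A`). [cite: Chenevier2014, §3.1] -/
theorem isDeformation_map (φ : 𝓡.R →ₐ[𝒪] A) : 𝒟.IsDeformation πA (𝓡.triple.map (φ : 𝓡.R →+* A)) :=
  𝓡.isDeformation.map 𝒟 𝓡.π_surjective πA hπA φ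

end Classify

end OrdinaryDeterminantDeformationRing

/-! ### The construction, as a named fact -/

/-- **Existence of the universal ordinary determinant deformation ring framed by local
characters** (named fact).  Let `k` be a finite field of characteristic `p`, `𝒪` a coefficient
ring (complete Noetherian local) with residue field `k`, `F` a number field and `𝒟` an ordinary
determinant residual datum.  Then the functor `A ↦ {deformations of 𝒟 to A}` on complete
Noetherian local `𝒪`-algebras with residue field `k` is pro-represented by an
`OrdinaryDeterminantDeformationRing 𝒟` (test rings in `Type`).  WHAT IS PRINTED WHERE.
(1) [Che, Prop. 3.3 with Lemma 3.2] (= Prop. E): for a profinite group `G` and a continuous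
determinant `D̄ : k[G] → k` of dimension `d`, the functor of continuous determinants lifting `D̄`
on profinite local `W(k)`-algebras with residue field `k` is represented by a profinite local
`W(k)`-algebra `A(ρ̄)` with residue field `k`, topologically generated by the coefficients
`Λ_i(g)` [Che, Remark 3.5], and Noetherian — a quotient of `W(k)[[t₁,…,t_h]]` — as soon as `G`
satisfies Mazur's finiteness condition (F) [Che, Prop. 3.7], which holds for `G_{F,S}` and for
`Γ_{F_v}` [Che, Example 3.6]; this is applied to `D̄` on `G_{F,S}` (determinants of `Γ_F`
unramified outside `S`) with `d = 2` and to each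
`ψ̄ᵢ⁽ᵛ⁾` on `Γ_{F_v}` with `d = 1` (determinants of dimension `1` are characters); by [Che, Lemma 1.9]
the determinants of dimension `2` are exactly the pairs `(T, det)` of `PseudoRep2`, and by
[Che, §2.30] continuity of a determinant is continuity of its coefficients `T`, `det`.  (2) The
product of these functors is pro-representable with finite tangent space, hence so is it over
the coefficient ring `𝒪` (Grothendieck's criterion [Maz, §18]: Mayer–Vietoris and finiteness of
the tangent space are what (1) provides), and the closed conditions `D|_{Γ_{F_v}} = ψ₁ ⊕ ψ₂`,
`ψ₂^m|_{I_v} = 1`, `det D(c) = -1` define a relatively representable subfunctor, represented by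
a quotient [Maz, §19]; the residual triple is a `k`-point, so the quotient is local with
residue field `k`.  (3) Folklore packaging: the `𝔪_R`-adic topology of a complete Noetherian
local ring with finite residue field is a compact Hausdorff ring topology, for which adically
continuous maps are continuous.  Nothing beyond (1)–(3) is asserted: no tangent-space or
dimension statement, no GMA structure, no `R = 𝕋`.
[cite: Chenevier2014, §3.1 Prop. 3.3, Remark 3.5, Example 3.6 and Prop. 3.7]
[cite: Mazur1997Deformation, §18–§19] -/
def ordinaryDeterminantDeformationRing_nonempty : Prop :=
  ∀ (F : Type) [Field F] [NumberField F] (p : ℕ) [Fact p.Prime] (𝒪 : Type) [CommRing 𝒪]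
    [IsLocalRing 𝒪] [IsNoetherianRing 𝒪] [IsAdicComplete (maximalIdeal 𝒪) 𝒪]
    (k : Type) [Field k] [Finite k] [CharP k p] [Algebra 𝒪 k]
    (𝒟 : OrdinaryDeterminantDatum F p 𝒪 k),
    Nonempty (OrdinaryDeterminantDeformationRing.{0} 𝒟)

end Literature.NumberTheory.GaloisRepresentations
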